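import Literature.Analysis.FluidPDE.OkamotoSakajoWunsch2008.SeparableBlowup
import Literature.Analysis.FluidPDE.OkamotoSakajoWunsch2008.CertificateP3
import HarnessLib

/-!
# OSW self-similar mechanism: local theory at the antipode, quantisation, the a → 1 branch (MECHANISM.md §§1–28: THEOREMS M1–M31) — part 01 of 26

1-D model (gCLM/OSW), computer-assisted; not Euler/NS.  Filed under `Summits/NavierStokesRegularity/OSWSelfSimilar/` by a prover-role courier on behalf of the
mechanism seat pub-oswblow-mech (planner-pub-oswblow-mech-g29-0), cell pub-oswblow (host summit NavierStokesRegularity); the gate admits the path but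
not role planner.  CONTENT = the staged transcript `pub-oswblow-mech/lean/OSWMechanism.lean` (sha256 9c32c87eb2d21b32…,
8958 lines), source lines 151–373, UNCHANGED except: (i) namespace prefix `OSWSelfSimilar.Mechanism` → `Summit.NavierStokesRegularity.OSWSelfSimilar.Mechanism`;
(ii) [parts >= 02 only: the frames open at the cut are re-opened above the body and closed at the end; nothing to re-open here]
(iii) this docstring and, below it, the transcript's own module documentation VERBATIM (renamed).  Generated by `pub-oswblow-mech/lean/courier/make_split.py`; the parts must be filed IN ORDER
(each imports its predecessor).  First/last declarations here: `fR` … `M5OneStatement` (26 in this part).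
AI-written transcript; kernel-checked on the farm as ONE file before splitting (see the kit's CHECKS); to be checked, not trusted.
-/

/-!
# OSW separable profiles on the circle: local theory at the antipode — STATEMENTS of M1 / M2 / M4,
# of the Fourier-tail law (v2), of the mirror statements M5 / M6 at infinity on the line (v3),
# the algebra of the Fredholm count M7 (v4), the analyticity statements M8 / M9 (v5),
# the analyticity statements M10 / M11 on the line and through infinity (v6),
# the algebra of the non-degeneracy theorem M12 (v7),
# the algebra of the Hölder-frame theorem M13 — (N1) as one real number (v8),
# the algebra of the dynamical theorem M14 / jet law / radius law — what p(a) does (v9),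
# the one-signed-profile statements of §17 with their kernel-checked arithmetic (v10),
# and the sign-changing class of §18: covers (kernel-checked), the local exponent at a general stagnation
# point, the statements M16 / M17 / M18 / Prop. 18.5–18.6, and the kernel-checked algebra of §18 (v11;
# at the gen-12 close also Prop. 18.6′ 'antiperiodicity kills solutions — the twisted subclass is empty',
# FULLY kernel-checked: `twisted_vanishes_on_U` (the ODE algebra on {g ≠ 0}) + `fR_eq_zero_of_vanish_on_U`
# (Parseval: f = 0 on {g ≠ 0} ⇒ f ≡ 0) ⇒ `twisted_vanishes`, `twistedEmptyStatement_holds`, `deckOdd_sector_vanishes`;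
# with the FUNCTION-side hypotheses via the coefficient formula `fourierCoeff_formula` / `fourierEval_injective`:
# `twisted_vanishes_fn`, `evenAbout_vanishes`, `twistedEmptyFnStatement_holds`, `noEvenSolutionStatement_holds`)
# Prop. 18.6 IN FULL (`oddAboutInteriorStatement_holds`: odd about an interior x₂ ⇒ x₂ = jπ/m and c = D_m c',
# c' a class-(H) solution — via the period ideal `periodIdeal` of ℤ and Lemma 18.1 (c) `holderProfileHyp_of_coverSeq`);
# reduction `mechanismV11_of_reduced`: MechanismStatementV11 ⇐ V10 ∧ the seven analytic statements of §18;
# `TransitSlopeStatement` re-typed with the hypothesis x₂ ∈ ∂J of Lemma 17.5 (Remark 18.2′) and then PROVED: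
# Lemma 17.5 kernel-checked in full (`transitSlopeStatement_holds`, via `g ∈ C¹, g' = Hf` = `hasDerivAt_gR`, the
# logarithmic rate `(Hf−1)/(a g)` of (T1), the mean-value bound `|g| ≤ B·(t−x₂)` and `∫ dt/(t−x₂) = ∞`), so that
# `mechanismV11_of_reduced6`: MechanismStatementV11 ⇐ V10 ∧ the SIX remaining analytic statements of §18
# and Remark 18.2′ kernel-checked (v11i): at a stagnation point with f(x₂) ≠ 0, on each side g ≠ 0 or g ≡ 0 near x₂
# (`stagnationSideDichotomy_holds`; the mixed case dies by Lemma 17.5 at both ends of a component, `no_component_with_live_ends`),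
# hence Hf(x₂) = 1 or g ≡ 0 on a neighbourhood of x₂ (`transitOrFlatStatement_holds` — the dichotomy (α)/(β), Question Q18.β)
# and Prop. 18.5 kernel-checked IN FULL (v11j): a degenerate stagnation point of finite order (g ~ c₀ y^{n+1}, n ≥ 1)
# forces f(x₂ + y) = o(|y|^k) for every k (`degenerateFlatStatement_holds`, via the one-sided ENGINE `log_rate_engine`:
# f(x₂) = 0, |(log|f|)'| ≥ K/(t−x₂) with K as large as we please ⇒ |f(y)| ≤ |f(x₁)|((y−x₂)/(x₁−x₂))^K or f ≡ 0),
# so that `mechanismV11_of_reduced5`: MechanismStatementV11 ⇐ V10 ∧ the FIVE remaining analytic statements of §18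
# and (v12) the kernel-checked algebra of §19 / Theorem M20 — the linearised similarity flow in the ENERGY scale:
# endpoint values of the local multiplier d_loc (`dloc_zero_eq`, `dloc_pi_eq`), the energy window (`energyWindow_iff`),
# the family optimum −(1+G(π)) below the Hölder optimum −1 (`ratePi_at_zero_lt`), the collapse `d_loc + c = 1 − (1 − 3a/2)h`
# for ρ₁ (`dtwo_rho1`), and the sign identity on ℤ×ℤ that is the exact commutator [H, cot(·/2)] (`cotComm_sign`, `hankel_factor`)
# and (v13) the FLAT ALTERNATIVE (β) of Remark 18.2′ anatomised (MECHANISM.md §18.2″, Prop. 18.8 / Cor. 18.10): the axiom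
# `NoFlatHyp` (Z(g) has empty interior; class (H^w) := (H) + it), KERNEL-CHECKED `Hf = 0` on/at the ends of a flat interval,
# Prop. 18.8(b)(i) `f = 0` at a flat-interval endpoint (`flatEndpoint_f_eq_zero`), Prop. 18.8(c): (T1) fails at x iff x lies on a
# flat interval with f(x) ≠ 0 (`flat_iff_T1_fails`), and Cor. 18.10: under `NoFlatHyp`, (T1) at every point and unit strain at
# every stagnation point with f ≠ 0 (`pointwise_T1_of_noFlat`, `transitSlope_of_noFlat` — Lemma 17.5 with no ∂J hypothesis);
# typed, not checked: `FlatAnalyticStatement` (18.8(a)), `FlatEndpointStatement` (18.8(b)(ii)); Question Q18.β′ stays OPEN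
# and (v14–v16b, sections `SourceInequality`, `ShapeClasses`, `DustExclusion`, `LayerBounds`, `ConjugateEquation`, `ShapeCriteria` at the end of
# the file) the kernel-checked algebra of the source inequality M21/M22 (§20), the shape classes M23 (§20.9–20.10), dust exclusion
# (§20.11), the amplitude / mass / forced-layer bounds M24–M25 (§21), and (v16) the CONJUGATE PROFILE EQUATION of §22: the algebra
# from `a(H(gF))' = Hf − ((1+a)/2)((Hf)² − f²)` at the two stagnation points to the identities (I1)–(I3) (THEOREM M26), the disc /
# coefficient forms (Cor. 22.3), and the shape-class bounds of THEOREM M27 (strain envelope, `‖f‖_∞ ≤ (π/2)Hf(0)`, `F ≤ M cot(x/2)`,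
# `F ≤ 6πB₀/x²`, `x_m < 4.08√B₀`, `M·|f'(0)| ≥ A₀²/2`, ladder forms); typed, not checked: `ConjugateEquationStatement` (22.2),
# `StagnationSourceStatement` / `StagnationSinkStatement` (I1)/(I2), `LogEnergyStatement`, `StrainEnvelopeStatement`,
# `ShapeAmplitudeStatement`, `MassSlopeStatement`, `MechanismStatementV16`;
# and (v17, section `AOneLimit`) the algebra of the De Gregorio end a ↑ 1 of §23: the linearised operator as the two-term recursion
# `(𝓛φ)_j = α_j φ_{j+1} − β_j φ_{j−1}` (its kernel = the first mode: `recursion_kernel`), the explicit corrector coefficients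
# `φ⁰_k = (−1)^{k−1}2k/((k−1)²(k+1))` solving it (`phi0_recursion`, `phi0_eq_one/two`), the exact rational identities behind
# `p = 1 + 2ε + (3+π²/4)ε² + c₃ε³ + O(ε⁴)` (`p_expansion_order2/3`), `3.4 < σ = 1 + π²/4 < 3.5`, and the partial fractions of (23.6)/(23.7)
# and (v18, section `ContractionAOne`) the corrector equation as a contraction (§24): the inverse `𝓛⁻¹` in closed form —
# `α_j w_{j+1} = 1/j = β_j w_{j−1}` (`alphaRec_mul_wTail`, `betaRec_mul_wTail`), (24.2) solves the recursion (`invCoeff_solves_recursion`,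
# `inverse_solves_one/two`, `oddStepSum_step`), the Hardy feed `k·w_k ≤ 8/k`, the sink-functional checks, the algebra and exponent
# windows of THEOREM M28, the [Chen21] dictionary for either sign of `c_ω`, `M(π/2) = ½ + π/4 + Cl₂(π/2)`, `(24.13) ⇒ (24.14)`; typed:
# `InverseBoundStatement`, `SinkFunctionalStatement`, `AnalyticBranchStatement`, `LocalUniquenessStatement`, `MechanismStatementV18`,
# and the OPEN `SigmaOneClosedFormConjecture` (σ₁ in closed form, numerically identified to 259 digits)
# and (v19, section `DilationMode`) the broken dilation mode (§25): the kernel `T′` of the dilation defect `[x∂ₓ, H_𝕋]`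
# (`hasDerivAt_tCot`), the first moment of `sin kx` (`integral_x_sin`), THEOREM 25.3 in abstract form (`dilation_decomposition`,
# `theta_of_split`, `theta_leading`), the sign of Lemma 25.2 (`tan_half_gt_half`, `rhoH_pos_of_split`), the constants `2·(1/12π)/(1/4π) = 2/3`
# (`two_K1_over_K3`, `theta_route_i`, `dlog_layer_width`) and the algebra of CONJECTURE M29 (`inv_rate_of_theta`, `sPi_of_theta`); typed:
# `SinkMomentStatement` (Lemma 25.2), `RhoHVanishingConjecture` (M29(b), OPEN), `MechanismStatementV19`
# and (v20, section `OuterRegion`) the shoulder and the outer region (§26): the algebra of the strain envelopes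
# `h ≤ B₀(2x cos²(x/2)/(x − sin x) − 1) < 12B₀/x² − B₀` (`envelope_a_algebra`, `envelope_b_algebra`, `sigma_chain`, `xh_of_strain`),
# the velocity bound `Γ² = 48A₀B₀` (`gamma_opt`), the stage-1 decay exponent (`stage1_exponent`), `∫y³e^{−y/λ}` (`hasDerivAt_y3exp`),
# the two-sided order of ρ_H (`moment_key`, `rhoH_lower`, `rhoH_upper`), the limit lemma (`tendsto_ratio_of_sq_bound`) and the SPINE
# `rhoH_vanishing_of_order`; typed: `ShoulderEnvelopeStatement`, `VelocityBoundStatement`, `OuterDecayStatement`, `RhoHOrderStatement`,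
# `RhoHVanishingInShapeClass` (M29(b) in 𝒮, PROVED pen-and-paper), `MechanismStatementV20`
# and (v21, section `LayerMass`) the two-sided layer law in `𝒮` except the slope (§27, THEOREM M30): the far-region bound from
# the defect identity (`far_parts_bound`), the two-sided logarithmic energy `R(1 − D) ≤ E_Λ/π < R` (`energy_lower_of_split`,
# `defect_form`, `decay_at_Xstar`, `defect_total`, spine `tendsto_ratio_one_of_defect`), the mass floor `M ≥ E_Λ/(πΓ)` (`R_over_Gamma`,
# typed reduction `massLower_of : VelocityBoundStatement → LogEnergyLowerStatement → MassLowerStatement`), the bathtub window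
# (`hasDerivAt_bathtub_window`), the curvature identity (`hasDerivAt_neg_cot_half`), and the Jordan-type bound `x − sin x ≥ (x²/6) sin x`
# now PROVED (`jordan_sixth`; it was a typed hypothesis of `tail_chain`/`sigma_chain`); typed: `StrainVariationStatement`,
# `FarRegionStatement`, `LogEnergyLowerStatement`, `MassLowerStatement`, `BathtubEnergyStatement`, `MechanismStatementV21`
# and (v22, section `SlopeLaw`) THE SLOPE LAW IN THE LOG-CONCAVE CLASS (§28, THEOREM M31, CONDITIONAL on (LC): log(F/sin x) concave):
# the Jensen lower slope constant (`jensen_slope_clean`, `jensen_slope_refined`, `jensen_consts`), the structure of 𝒮_LC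
# (`cot_rate_at_max`, `psi_deriv_transport`, `lc_strain_form`, `balance_poly`, `F3_of_balance`, `u2_of_balance`, `psi2_at_zero`,
# `lc_at_source_iff`), the chord/tangent envelopes (`chord_of_convexOn`, `secant_of_convexOn`, `hasDerivAt_env_chord`,
# `env_chord_integral`, `source_side_of`), the logarithmic mean `√s < (s−1)/log s` and `φ` increasing (`logmean_gt_sqrt`,
# `phi_strictMonoOn`, `tstar_lt_sq`, `tstar_le_weak`), the sink side (`hasDerivAt_x2exp`, `sink_bracket_le`, `theta_form`,
# `xm_lower_a_of`, `xm_lower_b_of`), the slope law algebra (`slope_upper_of`, `cos_xm_lower`, `slope_explicit_of`), `s cot s`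
# decreasing (`s_cot_strictAntiOn`) and the velocity chain (`velocity_lower_of`); typed: `LogConcaveHyp`, `LCImpliesShapeStatement`,
# `JensenSlopeStatement`, `VelocityLowerStatement`, `SlopeChordStatement`, `XmLowerStatement`, `SlopeLawStatement`,
# `LogConcavityConjecture` (OPEN), `MechanismStatementV22`; typed reduction `slopeLaw_of : SlopeChordStatement → XmLowerStatement →
# SlopeLawStatement` (kernel-checked)

**1-D model (gCLM/OSW), computer-assisted; not Euler/NS.**
Staged by cell pub-oswblow, seat `pub-oswblow-mech` (v1: planner-pub-oswblow-mech-0; v2: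
planner-pub-oswblow-mech-g2-0; v3: planner-pub-oswblow-mech-g3-0; v4: planner-pub-oswblow-mech-g5-0;
v5: planner-pub-oswblow-mech-g6-0; v6: planner-pub-oswblow-mech-g7-0; v7: planner-pub-oswblow-mech-g8-0;
v8: planner-pub-oswblow-mech-g9-0; v9: planner-pub-oswblow-mech-g10-0; v10: planner-pub-oswblow-mech-g11-0;
v11: planner-pub-oswblow-mech-g12-0; v12: planner-pub-oswblow-mech-g13-0, 2026-08-19; v13: planner-pub-oswblow-mech-g14-0, 2026-08-20; v14: planner-pub-oswblow-mech-g15-0; v15: planner-pub-oswblow-mech-g16-0;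
v16 and v16b (§22.9, section `ShapeCriteria`): planner-pub-oswblow-mech-g17-0, 2026-08-20; v17 (section `AOneLimit`): planner-pub-oswblow-mech-g18-0, 2026-08-20; v18 (section `ContractionAOne`): planner-pub-oswblow-mech-g19-0, 2026-08-20; v19 (section `DilationMode`): planner-pub-oswblow-mech-g20-0, 2026-08-20; v20 (section `OuterRegion`): planner-pub-oswblow-mech-g21-0, 2026-08-20; v21 (section `LayerMass`): planner-pub-oswblow-mech-g22-0, 2026-08-20; v22 (section `SlopeLaw`): planner-pub-oswblow-mech-g23-0, 2026-08-20).  Source of truth for the mathematics: `pub-oswblow-mech/MECHANISM.md` (v22).  v2 is written over the LANDED vocabulary of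
`Literature.Analysis.FluidPDE.OkamotoSakajoWunsch2008.SeparableBlowup` (`fourierEval`, `hilbertCoeff`,
`velocityEval`, `IsRealSeq`, `IsOddSeq`, `HasAntipodalOrder`), so that the statements below interlock
with the cell's typed target `AnalyticSeparableProfile`.

The theorems M1, M2, M4 and the tail law are **proved in MECHANISM.md (pen and paper), NOT
kernel-checked**.  They are recorded as closed `Prop`s (`def … : Prop`), with no `axiom` and no
`sorry`, so that a later seat can prove them or cite them by name; nothing here is used as a
hypothesis anywhere in the tree.  By the cell rule "new mathematics under `Summits/<S>/…`" this file
belongs in `Summits/NavierStokesRegularity/OSWSelfSimilar/` (operator-created; absent at the time of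
writing), NOT in `Literature/` (M1/M2/M4 are not published results); moving it there changes only the
namespace line.

Conventions (those of the imported file): a function on `ℝ/2πℤ` is an absolutely convergent Fourier
series `fourierEval c x = Σ c_k e^{ikx}`; the periodic Hilbert transform has multiplier `-i·sgn k`
(`H sin = -cos`); `g = velocityEval c` is the mean-zero primitive of `Hf` (`= ∫₀ˣ Hf` for odd `f`).
The profile equation (T1) `f = -a g f' + f·Hf` gives `a g f' = f (Hf - 1)` wherever `f'` exists.
At the antipode `x = π` (`g(π) = 0`, `g'(π) = Hf(π)`) the *antipodal indicial exponent* is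
  `p(a) = (1 - 1/Hf(π)) / a`                                        (MECHANISM.md (2.2)).
* Lemma 2.2 (structure): `f(π+y) = C·sgn(y)·|y|^p·E(y)`, `C ≠ 0`, `E` even continuous, `E(0) = 1`.
* Theorem M1 (trichotomy): `p ∉ ℕ` ⇒ `f` exactly `C^{⌊p⌋, p-⌊p⌋}` at `π`; `p` odd ⇒ `f ∈ C^∞` near
  `π`; `p = 2m` even ⇒ `f ∈ C^{2m-1,1} ∖ C^{2m}` at `π`.
* Theorem M2: `f ∈ C^{⌊p⌋+1}` near `π` (a fortiori smooth / analytic) ⇒ `p ∈ 2ℕ+1`, i.e.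
  `Hf(π) = -1/((2n+1)a - 1)`.
* Theorem M4 (v2, conormal structure): `|∂ʲ_y f(π+y)| ≤ K_j |y|^{p-j}` for ALL `j`, and
  `f(π+y) - C sgn(y)|y|^p` is conormal of order `p + min(2, p-η)`.
* Tail law (Prop. 4.4, unconditional in v2): if `f` is smooth off `π` and `p ∉ 2ℕ+1`, the sine
  coefficients satisfy `(-1)^k b_k k^{p+1} → Λ(a) = (2/π)·C·Γ(p+1)·cos(πp/2) ≠ 0`.
* Theorem M7 (v4, MECHANISM.md §11, the Fredholm count): at a smooth quantised profile of antipodal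
  order `P`, the linearised profile map on `X^{k,β} = {φ ∈ C^{k,β}_odd : sin·φ' ∈ C^{k,β}}` is
  Fredholm of index `1 - [k ≥ 1] - [k ≥ P]` (local transport part; the nonlocal part is one
  derivative smoothing), the full linearisation in `(φ, a)` has index one more, and (Prop. 11.6) the
  residue obstruction at the antipode of the branch tangent equals `ṗ = p'(a*)`.  M7 is NOT typed
  here (Mathlib has no Banach space of periodic `C^{k,β}` functions and no Fredholm index); only its
  two pieces of pure algebra are kernel-checked: the index bookkeeping `indexLloc` /
  `indexLloc_drop_at_antipode`, and the identity "residue = ṗ" (`residue_eq_pdot`), which is the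
  computation `u_P = ρ/(aCHf(π)) = -P/a + Hḟ(π)/(a Hf(π)²)` of Prop. 11.6(ii) using `1 - aP = 1/Hf(π)`.
* Theorem M8 / Corollary M9 (v5, MECHANISM.md §12, analyticity; proved with pen and paper, NOT
  kernel-checked): `f`, `Hf` are real-analytic wherever `g ≠ 0` (Lemma 12.2, a Lewy-type
  continuation of the complexified profile equation, whose only coefficient `f + iHf` is holomorphic
  in the upper half-plane); `p ∈ 2ℕ+1` ⇒ `f`, `Hf` real-analytic on an arc around `π` (Theorem M8:
  one-sided Briot–Bouquet fixed point at the stagnation point + Grönwall uniqueness on the diameter +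
  Painlevé gluing); hence, when the zero set of `g` is `πℤ` and `Hf(0) ≠ 0`: `f ∈ C^∞ ↔ f ∈ C^ω ↔`
  both indicial exponents odd (Corollary M9).  Typed below as `InteriorAnalyticStatement`,
  `M8Statement`, `M8IffStatement`, `M9Statement`, `MechanismStatementV5`.
Kernel-checked here: the algebra `p = 2n+1 ↔ Hf(π) = -1/((2n+1)a-1)` (`exponent_odd_iff`),
`Λ = 0 ↔ p odd` for `C ≠ 0`, `p > 0` (`tailConstant_eq_zero_iff`), the bridge
"structure with odd integer `p = P` ⇒ `HasAntipodalOrder c P`" (`hasAntipodalOrder_of_structure`),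
(v4) `indexLloc_drop_at_antipode`, `residue_eq_pdot`, and (v5) the two pieces of algebra of §12:
`indicialQ_zero_iff` ((12.6): the equilibrium condition of the Briot–Bouquet system is the indicial
law) and `sideRatio_eq_one_iff_odd` ((12.9): the two one-sided data at `π` agree iff `p` is odd).
-/

noncomputable section

open Complex Set Filter
open scoped Topology
open Literature.Analysis.FluidPDE.OkamotoSakajoWunsch2008

namespace Summit.NavierStokesRegularity.OSWSelfSimilar.Mechanism

/-! ### Real-valued profile, conjugate function and velocity (over the landed vocabulary) -/

/-- The profile `f` as a real function of `x : ℝ` (real part of the Fourier series). -/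
def fR (c : ℤ → ℂ) (x : ℝ) : ℝ := (fourierEval c x).re
/-- The conjugate function `Hf` (multiplier `-i sgn k`). -/
def HfR (c : ℤ → ℂ) (x : ℝ) : ℝ := (fourierEval (hilbertCoeff c) x).re
/-- `g = ∫₀ˣ Hf` (mean-zero primitive of `Hf`; OSW's velocity). -/
def gR (c : ℤ → ℂ) (x : ℝ) : ℝ := (velocityEval c x).re

/-- The open interval `(π - ε, π + ε)`. -/
def nearPi (ε : ℝ) : Set ℝ := Ioo (Real.pi - ε) (Real.pi + ε)

/-! ### Hypotheses (H) + (Lπ) of MECHANISM.md §1 -/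

/-- Standing hypotheses: `a ≠ 0`; `c` absolutely summable (so `f`, `Hf`, `g` are continuous functions
and `Hf` IS the conjugate function of `f`), real, odd; `f` is Hölder continuous of some order
`α ∈ (0,1)`; the profile ODE `a g f' = f (Hf - 1)` holds at every point where `g ≠ 0` (with `f`
differentiable there); at the antipode `Hf(π) ≠ 0` and `f` is not identically zero on any left
neighbourhood of `π`.  (Every `ExpDecay` solution of `IsSeparableProfile a c` with these sign/parity
properties satisfies them; the point of (H) is that only Hölder continuity is assumed at `π`.) -/
structure ProfileHyp (a : ℝ) (c : ℤ → ℂ) : Prop where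
  a_ne : a ≠ 0
  summable : Summable fun k : ℤ => ‖c k‖
  real : IsRealSeq c
  odd : IsOddSeq c
  holder : ∃ (K α : NNReal), 0 < α ∧ α < 1 ∧ HolderWith K α (fR c)
  ode : ∀ x : ℝ, gR c x ≠ 0 →
    DifferentiableAt ℝ (fR c) x ∧ a * gR c x * deriv (fR c) x = fR c x * (HfR c x - 1)
  hf_pi_ne : HfR c Real.pi ≠ 0
  nontrivial : ∀ δ : ℝ, 0 < δ → ∃ y : ℝ, 0 < y ∧ y < δ ∧ fR c (Real.pi - y) ≠ 0

/-- The antipodal indicial exponent `p(a) = (1 - 1/Hf(π))/a` (MECHANISM.md (2.2)). -/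
def antipodalExponent (a : ℝ) (c : ℤ → ℂ) : ℝ := (1 - 1 / HfR c Real.pi) / a

/-- The tail constant `Λ = (2/π)·C·Γ(p+1)·cos(πp/2)` of MECHANISM.md §4.4. -/
def tailConstant (C p : ℝ) : ℝ := 2 / Real.pi * C * Real.Gamma (p + 1) * Real.cos (Real.pi * p / 2)

/-! ### Statements (proved in MECHANISM.md, not kernel-checked) -/

/-- **Lemma 2.2 (structure at the antipode)** — proved in MECHANISM.md §2.2, not kernel-checked.
Under `ProfileHyp`, `p > 0` and `f(π + y) = C·sgn(y)·|y|^p·E(y)` on `|y| < δ` with `C ≠ 0`,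
`E` continuous, even, `E 0 = 1`. -/
def StructureStatement : Prop :=
  ∀ (a : ℝ) (c : ℤ → ℂ), ProfileHyp a c →
    0 < antipodalExponent a c ∧
    ∃ (C δ : ℝ) (E : ℝ → ℝ), C ≠ 0 ∧ 0 < δ ∧ ContinuousOn E (Ioo (-δ) δ) ∧ E 0 = 1 ∧
      (∀ y : ℝ, E (-y) = E y) ∧
      ∀ y : ℝ, |y| < δ →
        fR c (Real.pi + y) = C * Real.sign y * |y| ^ (antipodalExponent a c) * E y

/-- **Theorem M2 (smooth ⇒ quantised)** — proved in MECHANISM.md §3.4, not kernel-checked.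
If `f` is `C^∞` on a neighbourhood of `π` then `p(a)` is an odd positive integer. -/
def M2Statement : Prop :=
  ∀ (a : ℝ) (c : ℤ → ℂ), ProfileHyp a c →
    (∃ ε : ℝ, 0 < ε ∧ ContDiffOn ℝ (⊤ : ℕ∞) (fR c) (nearPi ε)) →
    ∃ n : ℕ, antipodalExponent a c = 2 * (n : ℝ) + 1

/-- **Theorem M2, sharp form** — proved in MECHANISM.md §3.4, not kernel-checked.
`C^{⌊p⌋+1}` near `π` already forces `p ∈ 2ℕ+1`. -/
def M2SharpStatement : Prop :=
  ∀ (a : ℝ) (c : ℤ → ℂ), ProfileHyp a c →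
    (∃ ε : ℝ, 0 < ε ∧
      ContDiffOn ℝ ((Nat.floor (antipodalExponent a c) + 1 : ℕ) : ℕ∞) (fR c) (nearPi ε)) →
    ∃ n : ℕ, antipodalExponent a c = 2 * (n : ℝ) + 1

/-- **Corollary 3.8 of M2** (the quantisation condition in terms of `Hf(π)`) — MECHANISM.md §3.3:
`f` smooth near `π` ⇒ `Hf(π) = -1/((2n+1)a - 1)` for some `n`. -/
def M2CorollaryStatement : Prop :=
  ∀ (a : ℝ) (c : ℤ → ℂ), ProfileHyp a c →
    (∃ ε : ℝ, 0 < ε ∧ ContDiffOn ℝ (⊤ : ℕ∞) (fR c) (nearPi ε)) →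
    ∃ n : ℕ, HfR c Real.pi = -1 / ((2 * (n : ℝ) + 1) * a - 1)

/-- **Theorem M1 (ii): odd exponent ⇒ smooth at the antipode** — MECHANISM.md §3.3, not
kernel-checked. -/
def M1OddStatement : Prop :=
  ∀ (a : ℝ) (c : ℤ → ℂ), ProfileHyp a c →
    (∃ n : ℕ, antipodalExponent a c = 2 * (n : ℝ) + 1) →
    ∃ ε : ℝ, 0 < ε ∧ ContDiffOn ℝ (⊤ : ℕ∞) (fR c) (nearPi ε)

/-- **Theorem M1 (i): non-integer exponent ⇒ exactly `C^{⌊p⌋, p-⌊p⌋}` at the antipode** —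
MECHANISM.md §3.3, not kernel-checked.  First conjunct: `f ∈ C^{n,θ}` near `π` (`n = ⌊p⌋`,
`θ = p - n`); second: for every `θ' > θ`, `f^{(n)}` is not `θ'`-Hölder on any neighbourhood of `π`. -/
def M1NonIntegerStatement : Prop :=
  ∀ (a : ℝ) (c : ℤ → ℂ), ProfileHyp a c →
    (∀ m : ℕ, antipodalExponent a c ≠ m) →
    let p := antipodalExponent a c
    let n := Nat.floor p
    (∃ (ε : ℝ) (K : NNReal), 0 < ε ∧ ContDiffOn ℝ (n : ℕ∞) (fR c) (nearPi ε) ∧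
        HolderOnWith K (Real.toNNReal (p - n)) (iteratedDeriv n (fR c)) (nearPi ε)) ∧
    (∀ θ' : NNReal, p - n < (θ' : ℝ) → (θ' : ℝ) ≤ 1 →
      ∀ (ε : ℝ) (K : NNReal), 0 < ε →
        ¬ HolderOnWith K θ' (iteratedDeriv n (fR c)) (nearPi ε))

/-- **Theorem M1 (iii): even exponent `p = 2m` ⇒ `C^{2m-1,1}` but not `C^{2m}` at the antipode**
(`f^{(2m)}` jumps by `2·(2m)!·C`) — MECHANISM.md §3.3, not kernel-checked. -/
def M1EvenStatement : Prop :=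
  ∀ (a : ℝ) (c : ℤ → ℂ), ProfileHyp a c →
    ∀ m : ℕ, 1 ≤ m → antipodalExponent a c = 2 * (m : ℝ) →
    (∃ (ε : ℝ) (K : NNReal), 0 < ε ∧ ContDiffOn ℝ ((2 * m - 1 : ℕ) : ℕ∞) (fR c) (nearPi ε) ∧
        LipschitzOnWith K (iteratedDeriv (2 * m - 1) (fR c)) (nearPi ε)) ∧
    ∀ ε : ℝ, 0 < ε → ¬ ContDiffOn ℝ ((2 * m : ℕ) : ℕ∞) (fR c) (nearPi ε)

/-- **Theorem M4 (conormal structure at the antipode)** — MECHANISM.md §4.6 and Appendix A (v2),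
not kernel-checked.  Under (H)+(Lπ) alone: `f` is `C^∞` on a punctured neighbourhood of `π`;
`F(y) = f(π+y)` satisfies `|F^{(j)}(y)| ≤ K_j |y|^{p-j}` for EVERY `j` on `0 < |y| < δ`
(`F ∈ 𝒜^p`); and for every `η > 0`, `F - C·sgn·|y|^p ∈ 𝒜^{p + min(2, p-η)}` (MECHANISM.md proves the
slightly sharper order `p + min(2, p')`, `p' = p` unless `p ∈ 2ℕ`).  This is what makes the tail law
unconditional. -/
def M4Statement : Prop :=
  ∀ (a : ℝ) (c : ℤ → ℂ), ProfileHyp a c →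
    let p := antipodalExponent a c
    ∃ (C δ : ℝ), C ≠ 0 ∧ 0 < δ ∧
      ContDiffOn ℝ (⊤ : ℕ∞) (fR c) (nearPi δ \ {Real.pi}) ∧
      (∀ j : ℕ, ∃ K : ℝ, ∀ y : ℝ, 0 < |y| → |y| < δ →
        |iteratedDeriv j (fun y => fR c (Real.pi + y)) y| ≤ K * |y| ^ (p - j)) ∧
      (∀ η : ℝ, 0 < η → ∀ j : ℕ, ∃ K : ℝ, ∀ y : ℝ, 0 < |y| → |y| < δ →
        |iteratedDeriv j (fun y => fR c (Real.pi + y) - C * Real.sign y * |y| ^ p) y|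
          ≤ K * |y| ^ (p + min 2 (p - η) - j))

/-- **Proposition 4.4 (Fourier-tail law; unconditional in v2 via Theorem M4)** — MECHANISM.md §4.4,
not kernel-checked.  If in addition `f` is `C^∞` off the antipode (`{x | cos x ≠ -1}`; e.g. when the
exponent at the origin is odd) and `p ∉ 2ℕ+1`, then with `C = lim_{y↓0} f(π+y)/y^p ≠ 0` and the
sine coefficients `b_k = -2·Im c_k` of the real odd `f`:
`(-1)^k · b_k · k^{p+1} → Λ = (2/π)·C·Γ(p+1)·cos(πp/2) ≠ 0`.  Consequences recorded in
MECHANISM.md: LSS's spectral exponent is `p_b = p + 1` exactly; `f ∈ H^s(𝕋) ↔ s < p + 1/2`. -/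
def TailLawStatement : Prop :=
  ∀ (a : ℝ) (c : ℤ → ℂ), ProfileHyp a c →
    ContDiffOn ℝ (⊤ : ℕ∞) (fR c) {x : ℝ | Real.cos x ≠ -1} →
    (∀ n : ℕ, antipodalExponent a c ≠ 2 * (n : ℝ) + 1) →
    let p := antipodalExponent a c
    ∃ C Λ : ℝ, C ≠ 0 ∧
      Tendsto (fun y : ℝ => fR c (Real.pi + y) / y ^ p) (𝓝[>] 0) (𝓝 C) ∧
      Λ = tailConstant C p ∧ Λ ≠ 0 ∧
      Tendsto (fun k : ℕ => (-1 : ℝ) ^ k * (-2 * (c (k : ℤ)).im) * (k : ℝ) ^ (p + 1)) atTop (𝓝 Λ)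

/-- The full mechanism statement (v2): the conjunction recorded for citation by name. -/
def MechanismStatement : Prop :=
  StructureStatement ∧ M1OddStatement ∧ M1NonIntegerStatement ∧ M1EvenStatement ∧
    M2Statement ∧ M2SharpStatement ∧ M2CorollaryStatement ∧ M4Statement ∧ TailLawStatement

/-! ### v3 — the same mechanism at the point at infinity of the line (MECHANISM.md §10)

LSS's collapsing similarity profiles on `ℝ` (`ω = τ⁻¹ Φ(x/τ^α)`, `0 ≤ a < a_c`, `α > 0`; HQWW's
solutions with `c_l > 0`, `α = c_l/|c_ω|`) are read in LSS's chart `ξ = tan(q/2)`: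
`f(q) = Φ(tan(q/2))` is an odd Hölder function on `ℝ/2πℤ`, `h = Hf - Hf(π)` is the pull-back of
`H_ℝ Φ` (LSS 2021, Appendix; MECHANISM.md Lemma 10.1), `g(q) = ∫₀^q h/(1 + cos)` that of `∫₀^ξ H_ℝΦ`,
and the similarity equation becomes `T f' = f (h - 1)` with `T = α sin q + a (1 + cos q) g`.
At `q = π` (the point at infinity) `T(π) = 0`, `T'(π) = -α`, `h(π) = 0`: the indicial exponent is
`1/α` (Lemma 10.2) and the parity trichotomy of M1 holds there (Theorems M5, M6 of MECHANISM.md §10.4,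
proved with pen and paper, NOT kernel-checked). -/

/-- `h = Hf + C_f = Hf - Hf(π)`: the pull-back of `H_ℝ Φ` to the chart (MECHANISM.md Lemma 10.1(b)). -/
def hLine (c : ℤ → ℂ) (q : ℝ) : ℝ := HfR c q - HfR c Real.pi

/-- `g(q) = ∫₀^q h/(1 + cos)`: the pull-back of `G(ξ) = ∫₀^ξ H_ℝΦ` (MECHANISM.md Lemma 10.1(c)). -/
def gLine (c : ℤ → ℂ) (q : ℝ) : ℝ := ∫ t in (0 : ℝ)..q, hLine c t / (1 + Real.cos t)

/-- The transformed transport coefficient `T = α sin q + a (1 + cos q) g` (MECHANISM.md (T∞)). -/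
def transportLine (α a : ℝ) (c : ℤ → ℂ) (q : ℝ) : ℝ :=
  α * Real.sin q + a * (1 + Real.cos q) * gLine c q

/-- Hypotheses (H∞) of MECHANISM.md §10.1: `α > 0`; `c` absolutely summable, real, odd (so `f = fR c`
is a continuous odd function on `ℝ/2πℤ`, odd about `π` as well); `f` Hölder of some order in `(0,1)`;
the transformed similarity equation `T f' = f (h - 1)` at every `q ∈ (-π, π)` with `T q ≠ 0`; `f` not
identically zero on any left neighbourhood of `π` (i.e. `Φ ≢ 0` near infinity).  Lemma 10.1 of
MECHANISM.md derives these from the hypotheses (Hℝ) on `Φ` (in particular for HQWW's `c_l > 0`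
solutions). -/
structure LineChartHyp (α a : ℝ) (c : ℤ → ℂ) : Prop where
  α_pos : 0 < α
  summable : Summable fun k : ℤ => ‖c k‖
  real : IsRealSeq c
  odd : IsOddSeq c
  holder : ∃ (K β : NNReal), 0 < β ∧ β < 1 ∧ HolderWith K β (fR c)
  ode : ∀ q : ℝ, -Real.pi < q → q < Real.pi → transportLine α a c q ≠ 0 →
    DifferentiableAt ℝ (fR c) q ∧
      transportLine α a c q * deriv (fR c) q = fR c q * (hLine c q - 1)
  nontrivial : ∀ δ : ℝ, 0 < δ → ∃ y : ℝ, 0 < y ∧ y < δ ∧ fR c (Real.pi - y) ≠ 0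

/-- **Lemma 10.2 (structure at infinity)** — MECHANISM.md §10.2, not kernel-checked.
`f(π + y) = C·sgn(y)·|y|^{1/α}·E(y)` on `|y| < δ`, `C ≠ 0`, `E` even continuous, `E 0 = 1`;
equivalently `Φ(ξ) = -C sgn(ξ) (2/|ξ|)^{1/α} (1 + o(1))` at infinity. -/
def StructureAtInfinityStatement : Prop :=
  ∀ (α a : ℝ) (c : ℤ → ℂ), LineChartHyp α a c →
    ∃ (C δ : ℝ) (E : ℝ → ℝ), C ≠ 0 ∧ 0 < δ ∧ ContinuousOn E (Ioo (-δ) δ) ∧ E 0 = 1 ∧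
      (∀ y : ℝ, E (-y) = E y) ∧
      ∀ y : ℝ, |y| < δ → fR c (Real.pi + y) = C * Real.sign y * |y| ^ (1 / α) * E y

/-- **Theorem M6 (smooth through infinity ⇒ quantised similarity exponent)** — MECHANISM.md §10.4,
not kernel-checked.  If the collapse profile is `C^∞` through the point at infinity (i.e. `f` is
`C^∞` near `q = π`), then `1/α ∈ {3, 5, 7, …}` or `(α, a) = (1, 0)`. -/
def M6Statement : Prop :=
  ∀ (α a : ℝ) (c : ℤ → ℂ), LineChartHyp α a c →
    (∃ ε : ℝ, 0 < ε ∧ ContDiffOn ℝ (⊤ : ℕ∞) (fR c) (nearPi ε)) →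
    (∃ n : ℕ, 1 / α = 2 * (n : ℝ) + 3) ∨ (α = 1 ∧ a = 0)

/-- **Theorem M6, sharp form** — `C^{⌈1/α⌉}` near `π` already forces `1/α` odd (MECHANISM.md §10.4). -/
def M6SharpStatement : Prop :=
  ∀ (α a : ℝ) (c : ℤ → ℂ), LineChartHyp α a c →
    (∃ ε : ℝ, 0 < ε ∧ ContDiffOn ℝ ((Nat.ceil (1 / α) : ℕ) : ℕ∞) (fR c) (nearPi ε)) →
    ∃ n : ℕ, 1 / α = 2 * (n : ℝ) + 1

/-- **Theorem M5 (ii) + (iv, a = 0): odd exponent ⇒ smooth through infinity** — MECHANISM.md §10.4,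
not kernel-checked. -/
def M5OddStatement : Prop :=
  ∀ (α a : ℝ) (c : ℤ → ℂ), LineChartHyp α a c →
    ((∃ n : ℕ, 1 / α = 2 * (n : ℝ) + 3) ∨ (α = 1 ∧ a = 0)) →
    ∃ ε : ℝ, 0 < ε ∧ ContDiffOn ℝ (⊤ : ℕ∞) (fR c) (nearPi ε)

/-- **Theorem M5 (iv): the degenerate rung `1/α = 1`** — MECHANISM.md §10.4, not kernel-checked:
`f(π + y) = C y - (π a C²/2) y|y| + O(|y|^{2+β'})`, so `f ∈ C²` near `π` forces `a = 0`
(on LSS's branch `α = 1` happens exactly at `a = 0`, the CLM case). -/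
def M5OneStatement : Prop :=
  ∀ (a : ℝ) (c : ℤ → ℂ), LineChartHyp 1 a c →
    (∃ ε : ℝ, 0 < ε ∧ ContDiffOn ℝ (2 : ℕ∞) (fR c) (nearPi ε)) → a = 0

end Summit.NavierStokesRegularity.OSWSelfSimilar.Mechanism
end
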